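import Summits.Ventures.YMGap.RobustBall.StarFarLoadsZd
import HarnessLib

/-!
# Venture YMGap, track ROBUST-BALL (Y2) — crux «Y2-X2-P», STEP 3 / P2a: far LOADS at a vertex star for a GENERIC set weight `w`
# (meets-star mass, far star-link series, weighted far exterior series)

HONEST FRAMING. WHAT THIS IS: a venture file (cell `pub-ymgap`, track Y2 ROBUST-BALL, seat ds-2 (g15); lead R392 (B) STEP 3; theorems only,
0 compute). The far-load bookkeeping of the tier-2 `ℤ^d` star door (`StarFarEnergyZd.tsum_meets_star_weighted_lip_le`,
`StarFarLoadsZd.sum_star_farLip_le`, `StarFarLoadsZd.tsum_farExt_mul_exp_reach_le`) is written for the weight `e^{κ·diam X}` and the reach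
weight `e^{t(‖y−s‖+1)}`. The proofs use only: the weight is nonnegative, `1 ≤ φ·w X` on sets of diameter `≥ D`, and the reach weight of a link
of a far set is `≤ ψ·w X`. Here they are run ONCE for a GENERIC set weight `w ≥ 0` with `w`-weighted site-incidence Lipschitz loads `≤ ε₁`:
* `tsum_meets_star_wLip_le` — the `w`-weighted Lipschitz mass of the sets meeting the star of `s` is `≤ (d+1) ε₁`;
* `summable_far_meets_star_lip`, `sum_star_farLip_le_w` — for a tail factor `φ ≥ 0` with `1 ≤ φ·w X` whenever `diam X ≥ D`: the unweighted
  far mass is summable, the far star-link series `ℓ_x` are summable and `Σ_{x ∈ ⋆} ℓ_x ≤ (d+1) φ ε₁`;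
* `tsum_farExt_mul_weight_le_w` — for a link weight `ω ≥ 0` with `ω y ≤ ψ·w X` for the links of every far set: `Σ'_y L_y ω y ≤ (d+1) ψ ε₁`.
Instances: tier 2 (`w = e^{κ·diam}`, `φ = e^{−κD}`, `ψ = e^{2t}e^{−(κ−t)D}`) and tier 3 (`w = (1+diam)^p`, `φ = (1+D)^{−p}`, `ψ = (1+D)^{q−p}` for
the logarithmic reach — `StarFarLoadsZdP.lean`). These are exactly the far inputs of `star_contraction_of_farLoads` /
`starWindowBoundZdW_of_near_farLoads`. WHAT THIS IS NOT: no door, no number; nothing about the continuum or the Millennium problem.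
-/

noncomputable section

open MeasureTheory Function Finset Real
open scoped NNReal
open Literature.Probability.LatticeModels
open Literature.Probability.LatticeModels.DobrushinMetric
open Literature.MathematicalPhysics.QuantumLattice
open Literature.MathematicalPhysics.QuantumFieldTheory hiding ZdEdge
open Summit.Ventures.YMGap.DSWindowZd

namespace Summit.Ventures.YMGap.RobustBall

variable {d N : ℕ}

section Loads

variable {ε₁ : ℝ} {W : Potential (ZdEdge d) (SUN N)} {lip : Finset (ZdEdge d) → ZdEdge d → ℝ}
  {w : Finset (ZdEdge d) → ℝ}

/-! ### The weighted mass of the sets meeting a star -/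

/-- **The `w`-weighted Lipschitz mass of the sets meeting the star of `s` is at most `(d+1) ε₁`** (each such set is
based at one of the `d+1` sites `s, s − e_μ`; `w`-weighted site-incidence loads `≤ ε₁`). Generic-weight form of
`tsum_meets_star_weighted_lip_le`. [folklore] -/
theorem tsum_meets_star_wLip_le (hlip : ∀ X, IsLipBound suFrobDist (W X) (lip X)) (hw0 : ∀ X, 0 ≤ w X)
    (hlips : ∀ v : Site d, Summable fun X : Finset (ZdEdge d) =>
      (if (∃ μ : Fin d, ((v, μ) : ZdEdge d) ∈ X) then w X * ∑ y ∈ X, lip X y else 0))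
    (hlipa : ∀ v : Site d, ∑' X : Finset (ZdEdge d),
      (if (∃ μ : Fin d, ((v, μ) : ZdEdge d) ∈ X) then w X * ∑ y ∈ X, lip X y else 0) ≤ ε₁)
    (s : Site d) :
    (Summable fun X : Finset (ZdEdge d) =>
      (if (X ∩ vertexStarZd s).Nonempty then w X * ∑ y ∈ X, lip X y else 0)) ∧
    ∑' X : Finset (ZdEdge d),
      (if (X ∩ vertexStarZd s).Nonempty then w X * ∑ y ∈ X, lip X y else 0) ≤
        ((d : ℝ) + 1) * ε₁ := by
  classical
  set S : Finset (Site d) := insert s (Finset.univ.image fun μ : Fin d => s - Pi.single μ 1) with hS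
  set g : Finset (ZdEdge d) → ℝ := fun X => w X * ∑ y ∈ X, lip X y with hg
  have hg0 : ∀ X, 0 ≤ g X := fun X => mul_nonneg (hw0 X) (Finset.sum_nonneg fun y _ => (hlip X).nonneg y)
  -- domination by the sum over the `d+1` base sites
  have hdom : ∀ X, (if (X ∩ vertexStarZd s).Nonempty then g X else 0) ≤
      ∑ v ∈ S, (if (∃ μ : Fin d, ((v, μ) : ZdEdge d) ∈ X) then g X else 0) := by
    intro X
    split_ifs with hX
    · obtain ⟨v, hv, μ, hμ⟩ := exists_base_of_meets_star hX
      refine le_trans ?_ (Finset.single_le_sum (f := fun v => if (∃ μ : Fin d, ((v, μ) : ZdEdge d) ∈ X) then g X else 0)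
        (fun v _ => by split_ifs; exacts [hg0 X, le_rfl]) hv)
      simp only [if_pos (⟨μ, hμ⟩ : ∃ μ : Fin d, ((v, μ) : ZdEdge d) ∈ X), le_refl]
    · exact Finset.sum_nonneg fun v _ => by split_ifs; exacts [hg0 X, le_rfl]
  have hsumS : Summable fun X => ∑ v ∈ S, (if (∃ μ : Fin d, ((v, μ) : ZdEdge d) ∈ X) then g X else 0) :=
    summable_sum fun v _ => hlips v
  have h1 : Summable fun X : Finset (ZdEdge d) => (if (X ∩ vertexStarZd s).Nonempty then g X else 0) :=
    Summable.of_nonneg_of_le (fun X => by split_ifs; exacts [hg0 X, le_rfl]) hdom hsumS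
  refine ⟨h1, ?_⟩
  have hcard : (S.card : ℝ) ≤ (d : ℝ) + 1 := by
    have h := Finset.card_insert_le s (Finset.univ.image fun μ : Fin d => s - Pi.single μ 1)
    have h2 : (Finset.univ.image fun μ : Fin d => s - Pi.single μ 1).card ≤ d :=
      Finset.card_image_le.trans (by rw [Finset.card_univ, Fintype.card_fin])
    have : S.card ≤ d + 1 := h.trans (by omega)
    exact_mod_cast this
  calc ∑' X, (if (X ∩ vertexStarZd s).Nonempty then g X else 0)
      ≤ ∑' X, ∑ v ∈ S, (if (∃ μ : Fin d, ((v, μ) : ZdEdge d) ∈ X) then g X else 0) := h1.tsum_le_tsum hdom hsumS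
    _ = ∑ v ∈ S, ∑' X, (if (∃ μ : Fin d, ((v, μ) : ZdEdge d) ∈ X) then g X else 0) :=
        Summable.tsum_finsetSum fun v _ => hlips v
    _ ≤ ∑ v ∈ S, ε₁ := Finset.sum_le_sum fun v _ => hlipa v
    _ = S.card * ε₁ := by rw [Finset.sum_const, nsmul_eq_mul]
    _ ≤ ((d : ℝ) + 1) * ε₁ := by
        have hε₁ : 0 ≤ ε₁ := le_trans (tsum_nonneg fun X => by split_ifs; exacts [hg0 X, le_rfl]) (hlipa s)
        exact mul_le_mul_of_nonneg_right hcard hε₁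

/-! ### Far loads at a vertex star -/



/-- Pointwise domination of a far star-link Lipschitz term by `φ ×` the `w`-weighted Lipschitz mass of the sets
meeting the star, when `1 ≤ φ · w X` on the sets of diameter `≥ D` (every far set has diameter `≥ D`). [folklore] -/
theorem farLip_le_mul_meets (hlip : ∀ X, IsLipBound suFrobDist (W X) (lip X)) (hw0 : ∀ X, 0 ≤ w X) {φ : ℝ}
    (hφ0 : 0 ≤ φ) {D : ℕ} (hφ : ∀ X : Finset (ZdEdge d), (D : ℝ) ≤ linkDiamZd X → 1 ≤ φ * w X) (s : Site d)
    (x : ZdEdge d) (X : Finset (ZdEdge d)) :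
    (if ((X ∩ vertexStarZd s).Nonempty ∧ ¬ X ⊆ starNbhdZdR D s) ∧ x ∈ X then lip X x else 0) ≤
      φ * (if (X ∩ vertexStarZd s).Nonempty then w X * ∑ y ∈ X, lip X y else 0) := by
  have hs0 : 0 ≤ ∑ y ∈ X, lip X y := Finset.sum_nonneg fun y _ => (hlip X).nonneg y
  split_ifs with h1 h2 h2
  · obtain ⟨x₀, hx₀⟩ := h1.1.1
    rw [Finset.mem_inter] at hx₀
    have hdiam : (D : ℝ) ≤ linkDiamZd X := le_linkDiamZd_of_far hx₀.2 hx₀.1 h1.1.2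
    calc lip X x ≤ ∑ y ∈ X, lip X y := Finset.single_le_sum (fun y _ => (hlip X).nonneg y) h1.2
      _ = 1 * ∑ y ∈ X, lip X y := (one_mul _).symm
      _ ≤ (φ * w X) * ∑ y ∈ X, lip X y := mul_le_mul_of_nonneg_right (hφ X hdiam) hs0
      _ = φ * (w X * ∑ y ∈ X, lip X y) := by ring
  · exact absurd h1.1.1 h2
  · exact mul_nonneg hφ0 (mul_nonneg (hw0 X) hs0)
  · rw [mul_zero]

/-- **The unweighted Lipschitz mass of the FAR sets at the star of `s` is summable** (domination by `φ ×` the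
`w`-weighted mass of the sets meeting the star). [folklore] -/
theorem summable_far_meets_star_lip (hlip : ∀ X, IsLipBound suFrobDist (W X) (lip X)) (hw0 : ∀ X, 0 ≤ w X)
    (hlips : ∀ v : Site d, Summable fun X : Finset (ZdEdge d) =>
      (if (∃ μ : Fin d, ((v, μ) : ZdEdge d) ∈ X) then w X * ∑ y ∈ X, lip X y else 0))
    (hlipa : ∀ v : Site d, ∑' X : Finset (ZdEdge d),
      (if (∃ μ : Fin d, ((v, μ) : ZdEdge d) ∈ X) then w X * ∑ y ∈ X, lip X y else 0) ≤ ε₁)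
    {φ : ℝ} (hφ0 : 0 ≤ φ) {D : ℕ} (hφ : ∀ X : Finset (ZdEdge d), (D : ℝ) ≤ linkDiamZd X → 1 ≤ φ * w X)
    (s : Site d) :
    Summable fun X : Finset (ZdEdge d) =>
      (if (X ∩ vertexStarZd s).Nonempty ∧ ¬ X ⊆ starNbhdZdR D s then ∑ y ∈ X, lip X y else 0) := by
  classical
  obtain ⟨hms, -⟩ := tsum_meets_star_wLip_le (w := w) (ε₁ := ε₁) hlip hw0 hlips hlipa s
  refine Summable.of_nonneg_of_le (fun X => ?_) (fun X => ?_) (hms.mul_left φ)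
  · split_ifs
    · exact Finset.sum_nonneg fun y _ => (hlip X).nonneg y
    · exact le_rfl
  · have hs0 : 0 ≤ ∑ y ∈ X, lip X y := Finset.sum_nonneg fun y _ => (hlip X).nonneg y
    split_ifs with h1 h2
    · obtain ⟨x₀, hx₀⟩ := h1.1
      rw [Finset.mem_inter] at hx₀
      have hdiam : (D : ℝ) ≤ linkDiamZd X := le_linkDiamZd_of_far hx₀.2 hx₀.1 h1.2
      calc ∑ y ∈ X, lip X y = 1 * ∑ y ∈ X, lip X y := (one_mul _).symm
        _ ≤ (φ * w X) * ∑ y ∈ X, lip X y := mul_le_mul_of_nonneg_right (hφ X hdiam) hs0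
        _ = φ * (w X * ∑ y ∈ X, lip X y) := by ring
    · exact absurd h1.1 h2
    · exact mul_nonneg hφ0 (mul_nonneg (hw0 X) hs0)
    · rw [mul_zero]

/-- **The far star-link constants `ℓ_x` are summable and `Σ_{x ∈ ⋆} ℓ_x ≤ (d+1) φ ε₁`** when `1 ≤ φ · w X` on the
sets of diameter `≥ D` (every far set has diameter `≥ D`; `w`-weighted site-incidence loads `≤ ε₁`). Generic-weight
form of `sum_star_farLip_le`. [folklore] -/
theorem sum_star_farLip_le_w (hlip : ∀ X, IsLipBound suFrobDist (W X) (lip X)) (hw0 : ∀ X, 0 ≤ w X)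
    (hlips : ∀ v : Site d, Summable fun X : Finset (ZdEdge d) =>
      (if (∃ μ : Fin d, ((v, μ) : ZdEdge d) ∈ X) then w X * ∑ y ∈ X, lip X y else 0))
    (hlipa : ∀ v : Site d, ∑' X : Finset (ZdEdge d),
      (if (∃ μ : Fin d, ((v, μ) : ZdEdge d) ∈ X) then w X * ∑ y ∈ X, lip X y else 0) ≤ ε₁)
    {φ : ℝ} (hφ0 : 0 ≤ φ) {D : ℕ} (hφ : ∀ X : Finset (ZdEdge d), (D : ℝ) ≤ linkDiamZd X → 1 ≤ φ * w X)
    (s : Site d) :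
    (∀ x, Summable fun X : Finset (ZdEdge d) =>
      (if ((X ∩ vertexStarZd s).Nonempty ∧ ¬ X ⊆ starNbhdZdR D s) ∧ x ∈ X then lip X x else 0)) ∧
    ∑ x ∈ vertexStarZd s, ∑' X : Finset (ZdEdge d),
        (if ((X ∩ vertexStarZd s).Nonempty ∧ ¬ X ⊆ starNbhdZdR D s) ∧ x ∈ X then lip X x else 0) ≤
      ((d : ℝ) + 1) * φ * ε₁ := by
  classical
  obtain ⟨hms, hmb⟩ := tsum_meets_star_wLip_le (w := w) (ε₁ := ε₁) hlip hw0 hlips hlipa s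
  have hnn : ∀ x X, 0 ≤ (if ((X ∩ vertexStarZd s).Nonempty ∧ ¬ X ⊆ starNbhdZdR D s) ∧ x ∈ X then lip X x else 0) :=
    fun x X => by split_ifs; exacts [(hlip X).nonneg x, le_rfl]
  have hsx : ∀ x, Summable fun X : Finset (ZdEdge d) =>
      (if ((X ∩ vertexStarZd s).Nonempty ∧ ¬ X ⊆ starNbhdZdR D s) ∧ x ∈ X then lip X x else 0) :=
    fun x => Summable.of_nonneg_of_le (hnn x) (farLip_le_mul_meets hlip hw0 hφ0 hφ s x) (hms.mul_left φ)
  refine ⟨hsx, ?_⟩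
  rw [← Summable.tsum_finsetSum (fun x _ => hsx x)]
  -- termwise: the star links of a far set carry at most `φ · w X · Σ lip`
  have hterm : ∀ X : Finset (ZdEdge d),
      ∑ x ∈ vertexStarZd s, (if ((X ∩ vertexStarZd s).Nonempty ∧ ¬ X ⊆ starNbhdZdR D s) ∧ x ∈ X then lip X x else 0)
        ≤ φ *
          (if (X ∩ vertexStarZd s).Nonempty then w X * ∑ y ∈ X, lip X y else 0) := by
    intro X
    have hs0 : 0 ≤ ∑ y ∈ X, lip X y := Finset.sum_nonneg fun y _ => (hlip X).nonneg y
    by_cases hF : (X ∩ vertexStarZd s).Nonempty ∧ ¬ X ⊆ starNbhdZdR D s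
    · rw [if_pos hF.1]
      obtain ⟨x₀, hx₀⟩ := hF.1
      rw [Finset.mem_inter] at hx₀
      have hdiam : (D : ℝ) ≤ linkDiamZd X := le_linkDiamZd_of_far hx₀.2 hx₀.1 hF.2
      calc ∑ x ∈ vertexStarZd s,
            (if ((X ∩ vertexStarZd s).Nonempty ∧ ¬ X ⊆ starNbhdZdR D s) ∧ x ∈ X then lip X x else 0)
          = ∑ x ∈ vertexStarZd s, (if x ∈ X then lip X x else 0) :=
            Finset.sum_congr rfl fun x _ => by
              by_cases hx : x ∈ X
              · rw [if_pos ⟨hF, hx⟩, if_pos hx]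
              · rw [if_neg (fun h => hx h.2), if_neg hx]
        _ = ∑ x ∈ vertexStarZd s ∩ X, lip X x := by rw [Finset.sum_ite_mem]
        _ ≤ ∑ x ∈ X, lip X x :=
            Finset.sum_le_sum_of_subset_of_nonneg Finset.inter_subset_right fun x _ _ => (hlip X).nonneg x
        _ = 1 * ∑ x ∈ X, lip X x := (one_mul _).symm
        _ ≤ (φ * w X) * ∑ y ∈ X, lip X y := mul_le_mul_of_nonneg_right (hφ X hdiam) hs0
        _ = φ * (w X * ∑ y ∈ X, lip X y) := by ring
    · refine (Finset.sum_eq_zero fun x _ => by rw [if_neg (fun h => hF h.1)]).le.trans ?_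
      exact mul_nonneg hφ0 (by split_ifs; exacts [mul_nonneg (hw0 X) hs0, le_rfl])
  calc ∑' X, ∑ x ∈ vertexStarZd s,
        (if ((X ∩ vertexStarZd s).Nonempty ∧ ¬ X ⊆ starNbhdZdR D s) ∧ x ∈ X then lip X x else 0)
      ≤ ∑' X, φ *
          (if (X ∩ vertexStarZd s).Nonempty then w X * ∑ y ∈ X, lip X y else 0) :=
        (summable_sum fun x _ => hsx x).tsum_le_tsum hterm (hms.mul_left _)
    _ = φ * ∑' X,
          (if (X ∩ vertexStarZd s).Nonempty then w X * ∑ y ∈ X, lip X y else 0) :=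
        tsum_mul_left
    _ ≤ φ * (((d : ℝ) + 1) * ε₁) := mul_le_mul_of_nonneg_left hmb hφ0
    _ = ((d : ℝ) + 1) * φ * ε₁ := by ring

/-- **The weighted exterior constants**: with `L_y = Σ'_{FAR ∋ y, y ∉ ⋆} lip_X(y)` and a link weight `ω ≥ 0` with
`ω y ≤ ψ · w X` for every link `y` of a far set `X` (meeting the star, leaving the box): `y ↦ L_y ω y` is summable and
`Σ'_y L_y ω y ≤ (d+1) ψ ε₁`. Generic-weight form of `tsum_farExt_mul_exp_reach_le`. [folklore] -/
theorem tsum_farExt_mul_weight_le_w (hlip : ∀ X, IsLipBound suFrobDist (W X) (lip X)) (hw0 : ∀ X, 0 ≤ w X)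
    (hlips : ∀ v : Site d, Summable fun X : Finset (ZdEdge d) =>
      (if (∃ μ : Fin d, ((v, μ) : ZdEdge d) ∈ X) then w X * ∑ y ∈ X, lip X y else 0))
    (hlipa : ∀ v : Site d, ∑' X : Finset (ZdEdge d),
      (if (∃ μ : Fin d, ((v, μ) : ZdEdge d) ∈ X) then w X * ∑ y ∈ X, lip X y else 0) ≤ ε₁)
    {D : ℕ} {s : Site d} {ω : ZdEdge d → ℝ} (hω0 : ∀ y, 0 ≤ ω y) {ψ : ℝ} (hψ0 : 0 ≤ ψ)
    (hψ : ∀ (X : Finset (ZdEdge d)) (y : ZdEdge d), (X ∩ vertexStarZd s).Nonempty → ¬ X ⊆ starNbhdZdR D s →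
      y ∈ X → ω y ≤ ψ * w X) :
    (Summable fun y : ZdEdge d => (∑' X : Finset (ZdEdge d),
        (if ((X ∩ vertexStarZd s).Nonempty ∧ ¬ X ⊆ starNbhdZdR D s) ∧ y ∈ X ∧ y ∉ vertexStarZd s
          then lip X y else 0)) * ω y) ∧
    ∑' y : ZdEdge d, (∑' X : Finset (ZdEdge d),
        (if ((X ∩ vertexStarZd s).Nonempty ∧ ¬ X ⊆ starNbhdZdR D s) ∧ y ∈ X ∧ y ∉ vertexStarZd s
          then lip X y else 0)) * ω y ≤
      ((d : ℝ) + 1) * ψ * ε₁ := by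
  classical
  obtain ⟨hms, hmb⟩ := tsum_meets_star_wLip_le (w := w) (ε₁ := ε₁) hlip hw0 hlips hlipa s
  -- the nonnegative double family
  set G : Finset (ZdEdge d) → ZdEdge d → ℝ := fun X y =>
    if ((X ∩ vertexStarZd s).Nonempty ∧ ¬ X ⊆ starNbhdZdR D s) ∧ y ∈ X ∧ y ∉ vertexStarZd s
      then lip X y * ω y else 0 with hG
  have hG0 : ∀ X y, 0 ≤ G X y := fun X y => by
    simp only [hG]; split_ifs; exacts [mul_nonneg ((hlip X).nonneg y) (hω0 y), le_rfl]
  have hFin : ∀ X, ∑' y, G X y = ∑ y ∈ X, G X y := fun X =>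
    tsum_eq_sum (s := X) fun y hy => by simp only [hG]; rw [if_neg (fun h => hy h.2.1)]
  -- per set: `Σ_{y ∈ X} G X y ≤ ψ · (weighted mass of X)`
  have hXle : ∀ X, ∑ y ∈ X, G X y ≤ ψ *
      (if (X ∩ vertexStarZd s).Nonempty then w X * ∑ y ∈ X, lip X y else 0) := by
    intro X
    have hs0 : 0 ≤ ∑ y ∈ X, lip X y := Finset.sum_nonneg fun y _ => (hlip X).nonneg y
    by_cases hF : (X ∩ vertexStarZd s).Nonempty ∧ ¬ X ⊆ starNbhdZdR D s
    · rw [if_pos hF.1]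
      have hωX : ∀ y ∈ X, ω y ≤ ψ * w X := fun y hy => hψ X y hF.1 hF.2 hy
      calc ∑ y ∈ X, G X y ≤ ∑ y ∈ X, lip X y * (ψ * w X) := by
            refine Finset.sum_le_sum fun y hy => ?_
            simp only [hG]
            split_ifs
            · exact mul_le_mul_of_nonneg_left (hωX y hy) ((hlip X).nonneg y)
            · exact mul_nonneg ((hlip X).nonneg y) (mul_nonneg hψ0 (hw0 X))
        _ = ψ * (w X * ∑ y ∈ X, lip X y) := by
            rw [← Finset.sum_mul]; ring
    · have h0 : ∑ y ∈ X, G X y = 0 := Finset.sum_eq_zero fun y _ => by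
        simp only [hG]; rw [if_neg (fun h => hF h.1)]
      rw [h0]
      exact mul_nonneg hψ0 (by split_ifs; exacts [mul_nonneg (hw0 X) hs0, le_rfl])
  have hsumX : Summable fun X => ∑' y, G X y := by
    simp_rw [hFin]
    exact Summable.of_nonneg_of_le (fun X => Finset.sum_nonneg fun y _ => hG0 X y) hXle (hms.mul_left _)
  have hunc : Summable (Function.uncurry G) :=
    (summable_prod_of_nonneg fun p => hG0 p.1 p.2).2
      ⟨fun X => summable_of_ne_finset_zero (s := X) fun y hy => by
        show G X y = 0; simp only [hG]; rw [if_neg (fun h => hy h.2.1)], hsumX⟩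
  -- summability in `y` of the `X`-sums (swap the product)
  have hswap : Summable fun p : ZdEdge d × Finset (ZdEdge d) => G p.2 p.1 := hunc.prod_symm
  have hy : Summable fun y : ZdEdge d => ∑' X, G X y :=
    ((summable_prod_of_nonneg fun p => hG0 p.2 p.1).1 hswap).2
  -- identify the weighted exterior series with `Σ'_y Σ'_X G`
  have hident : ∀ y : ZdEdge d, (∑' X : Finset (ZdEdge d),
      (if ((X ∩ vertexStarZd s).Nonempty ∧ ¬ X ⊆ starNbhdZdR D s) ∧ y ∈ X ∧ y ∉ vertexStarZd s
        then lip X y else 0)) * ω y = ∑' X, G X y := by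
    intro y
    rw [← tsum_mul_right]
    refine tsum_congr fun X => ?_
    simp only [hG]
    split_ifs <;> simp
  simp_rw [hident]
  refine ⟨hy, ?_⟩
  rw [hunc.tsum_comm]
  calc ∑' X, ∑' y, G X y ≤ ∑' X, ψ *
        (if (X ∩ vertexStarZd s).Nonempty then w X * ∑ y ∈ X, lip X y else 0) := by
        refine hsumX.tsum_le_tsum (fun X => ?_) (hms.mul_left _)
        rw [hFin]; exact hXle X
    _ = ψ * ∑' X,
        (if (X ∩ vertexStarZd s).Nonempty then w X * ∑ y ∈ X, lip X y else 0) :=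
        tsum_mul_left
    _ ≤ ψ * (((d : ℝ) + 1) * ε₁) := mul_le_mul_of_nonneg_left hmb hψ0
    _ = ((d : ℝ) + 1) * ψ * ε₁ := by ring

end Loads

end Summit.Ventures.YMGap.RobustBall

end
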